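import Literature.Barriers.QuantumAdvantage.TensorNetworkContractionRecords
import Literature.Computability.QuantumComplexity.ZOmegaCodeRing
import HarnessLib

/-!
# Barrier catalogue `QuantumAdvantage` — the records of the segment network on codes

Companion to `TensorNetworkContractionRecords.lean` (`NodeRec`: the integer records over `ℤ[ω]`
of the tensors of the segment network of a Clifford+`T` circuit, `NodeRec.eval`, `NodeRec.recOps`)
and `ZOmegaCodeRing.lean` (`ℤ[ω]` as a coded semiring). For the junction-tree engine on codes
(`JT.dpValueFP`) the factor operations must be realised on codes (`JT.CodeFactors`): we code a
record by `(kind, flag, scope)` (`recE`), read its scope off the code, and compute its entry at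
the assignment read off an association list by Boolean case analysis on the (ket, bra) bits of
the `≤ 4` values of its scope (**`codeFactors_rec`**); the entries have coefficient norm `≤ 1`
(`cn_eval_le`).

## References

* [MarkovShi2008] I. L. Markov, Y. Shi, SIAM J. Comput. 38 (2008) 963–981, §3 (Def 3.2, 3.4), §4 (Thm 4.6).
* S. Arora, B. Barak, *Computational Complexity*, CUP 2009, §1.3.
-/

noncomputable section

namespace Literature.Barriers.QuantumAdvantage

open Literature.Computability.Complexity Literature.Computability.Complexity.CodeFP
  Literature.Computability.QuantumComplexity Literature.Computability.QuantumComplexity.ZOmega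
  Literature.LinearAlgebra.TensorNetworks Literature.LinearAlgebra.TensorNetworks.JT
  Literature.Combinatorics.SimpleGraph.ListTD

namespace NodeRec

/-! ### The code of a record -/

/-- The kind of a record: `0` input, `1` H, `2` S, `3` T, `4` CNOT, `5` output, `6` dead. [folklore] -/
def kind : NodeRec → ℕ
  | input _ _ => 0
  | gateH _ _ => 1
  | gateS _ _ => 2
  | gateT _ _ => 3
  | gateCNOT _ _ _ _ => 4
  | output _ _ => 5
  | dead => 6

/-- The flag of a record (the bit of an input, the "measured" flag of an output). [folklore] -/
def flag : NodeRec → Bool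
  | input _ b => b
  | output _ m => m
  | _ => false

/-- **The code of a record**: `(kind, flag, scope)`. [folklore] -/
def recE : NodeRec → List Bool := fun r => pairE natE (pairE bitE (rawE natE)) (r.kind, r.flag, r.scope)

/-- The data on codes. [folklore] -/
theorem dataFP : CodeFP recE (pairE natE (pairE bitE (rawE natE))) (fun r => (r.kind, r.flag, r.scope)) :=
  ⟨_root_.id, PolyTimeComputable.id _, fun _ => rfl⟩

/-! ### The entries have small coefficients -/

/-- `ω² = i` in `ℤ[ω]`. [folklore] -/
theorem om_pow_two : om ^ 2 = (⟨gi, 0⟩ : ZOmega) := by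
  refine ZOmega.ext (Zsqrtd.ext ?_ ?_) (Zsqrtd.ext ?_ ?_) <;> simp [pow_two, om, gi]

/-- `ω⁴ = -1` in `ℤ[ω]`. [folklore] -/
theorem om_pow_four : om ^ 4 = -1 := by
  rw [show 4 = 2 * 2 from rfl, pow_mul, om_pow_two]
  refine ZOmega.ext (Zsqrtd.ext ?_ ?_) (Zsqrtd.ext ?_ ?_) <;> simp [pow_two, gi, Zsqrtd.re_mul, Zsqrtd.im_mul]

/-- `ω⁸ = 1` in `ℤ[ω]`. [folklore] -/
theorem om_pow_eight : om ^ 8 = 1 := by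
  rw [show 8 = 4 * 2 from rfl, pow_mul, om_pow_four, neg_one_sq]

/-- Powers of `ω` have coefficient norm `≤ 1`. [folklore] -/
theorem cn_om_pow_le_one (n : ℕ) : cn (om ^ n) ≤ 1 := by
  rw [← Nat.mod_add_div n 8, pow_add, pow_mul, om_pow_eight, one_pow, mul_one]
  obtain h | h | h | h | h | h | h | h : n % 8 = 0 ∨ n % 8 = 1 ∨ n % 8 = 2 ∨ n % 8 = 3 ∨ n % 8 = 4 ∨ n % 8 = 5 ∨
      n % 8 = 6 ∨ n % 8 = 7 := by omega
  all_goals rw [h]; decide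

/-- **Every entry has coefficient norm `≤ 1`.** [folklore] -/
theorem cn_eval_le (r : NodeRec) (a : ℕ → ℕ) : cn (r.eval a) ≤ 1 := by
  cases r with
  | input s bit => simp only [eval]; split_ifs <;> simp
  | gateH i o => simp only [eval]; split_ifs <;> simp [cn_neg]
  | gateS i o => simp only [eval]; split_ifs <;> first | exact cn_om_pow_le_one _ | simp
  | gateT i o => simp only [eval]; split_ifs <;> first | exact cn_om_pow_le_one _ | simp
  | gateCNOT cIn tIn cOut tOut => simp only [eval]; split_ifs <;> simp
  | output s m => simp only [eval]; split_ifs <;> simp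
  | dead => simp [eval]

/-! ### The entry on codes -/

/-- The (ket, bra) bits of the value of the `i`-th scope variable under `assignOf A`. [folklore] -/
def bitsAt (A : List (ℕ × ℕ)) (sc : List ℕ) (i : ℕ) : Bool × Bool :=
  (ketOf (assignOf A (sc.getD i 0)), braOf (assignOf A (sc.getD i 0)))

/-- `bitsAt` on codes (input `((A, sc), i)` with `i` fixed). [cite: AroraBarak2009, §1.3] -/
theorem bitsAtFP (i : ℕ) : CodeFP (pairE assocE (rawE natE)) (pairE bitE bitE) (fun q => bitsAt q.1 q.2 i) := by
  have hv : CodeFP (pairE assocE (rawE natE)) natE (fun q => assignOf q.1 (q.2.getD i 0)) :=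
    assignOfFP.comp ((fst _ _).pair ((rawGetD natE (d := 0) rfl).comp ((snd _ _).pair (const _ i))))
  have hk : CodeFP (pairE assocE (rawE natE)) bitE (fun q => ketOf (assignOf q.1 (q.2.getD i 0))) :=
    (natLe.comp ((const _ 2).pair hv)).congr fun q => by simp [ketOf]
  have hb : CodeFP (pairE assocE (rawE natE)) bitE (fun q => braOf (assignOf q.1 (q.2.getD i 0))) :=
    (natEq.comp ((natMod.comp (hv.pair (const _ 2))).pair (const _ 1))).congr fun q => by simp [braOf]
  exact (hk.pair hb).congr fun q => rfl

/-- **The entry as a function of the kind, the flag and the bits of the first four scope values**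
(the table of `NodeRec.eval`). [cite: MarkovShi2008, §3 (Def 3.2)] -/
def evalBits (k : ℕ) (fl : Bool) (b₀ b₁ b₂ b₃ : Bool × Bool) : ZOmega :=
  if k = 0 then (if b₀.1 = fl ∧ b₀.2 = fl then 1 else 0)
  else if k = 1 then (if ((b₀.1 && b₁.1) ^^ (b₀.2 && b₁.2)) then -1 else 1)
  else if k = 2 then (if b₀.1 = b₁.1 ∧ b₀.2 = b₁.2 then om ^ (2 * (if b₀.1 then 1 else 0) + 6 * (if b₀.2 then 1 else 0)) else 0)
  else if k = 3 then (if b₀.1 = b₁.1 ∧ b₀.2 = b₁.2 then om ^ ((if b₀.1 then 1 else 0) + 7 * (if b₀.2 then 1 else 0)) else 0)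
  else if k = 4 then (if (b₂.1 = b₀.1 ∧ b₃.1 = (b₁.1 ^^ b₀.1)) ∧ (b₂.2 = b₀.2 ∧ b₃.2 = (b₁.2 ^^ b₀.2)) then 1 else 0)
  else if k = 5 then (if b₀.1 = b₀.2 ∧ (fl = true → b₀.1 = true) then 1 else 0)
  else 0

/-- The table computes `eval`. [folklore] -/
theorem eval_eq_evalBits (r : NodeRec) (A : List (ℕ × ℕ)) :
    r.eval (assignOf A) = evalBits r.kind r.flag (bitsAt A r.scope 0) (bitsAt A r.scope 1) (bitsAt A r.scope 2) (bitsAt A r.scope 3) := by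
  cases r <;> simp [eval, evalBits, kind, flag, scope, bitsAt]

/-- The table on codes for a fixed kind and flag: a finite map of the eight bits. [folklore] -/
theorem evalBitsFP (k : ℕ) (fl : Bool) :
    CodeFP (pairE (pairE bitE bitE) (pairE (pairE bitE bitE) (pairE (pairE bitE bitE) (pairE bitE bitE)))) zoE
      (fun b => evalBits k fl b.1 b.2.1 b.2.2.1 b.2.2.2) :=
  ofFintype (pairE_injective (pairE_injective bitE_injective bitE_injective) (pairE_injective
    (pairE_injective bitE_injective bitE_injective) (pairE_injective (pairE_injective bitE_injective bitE_injective)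
      (pairE_injective bitE_injective bitE_injective)))) zoE _

/-- **The entry of a record on codes** (input `(record, A)`): dispatch on the kind (`< 7`) and the
flag, then the finite table of the bits. [cite: AroraBarak2009, §1.3] -/
theorem fevalFP : CodeFP (pairE recE assocE) zoE (fun p => p.1.eval (assignOf p.2)) := by
  have hdat := dataFP.comp (fst recE assocE)
  have hk : CodeFP (pairE recE assocE) natE (fun p => p.1.kind) := hdat.fst'
  have hfl : CodeFP (pairE recE assocE) bitE (fun p => p.1.flag) := hdat.snd'.fst'
  have hsc : CodeFP (pairE recE assocE) (rawE natE) (fun p => p.1.scope) := hdat.snd'.snd'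
  have hAs : CodeFP (pairE recE assocE) (pairE assocE (rawE natE)) (fun p => (p.2, p.1.scope)) := (snd _ _).pair hsc
  have hbits : CodeFP (pairE recE assocE) (pairE (pairE bitE bitE) (pairE (pairE bitE bitE) (pairE (pairE bitE bitE) (pairE bitE bitE))))
      (fun p => (bitsAt p.2 p.1.scope 0, (bitsAt p.2 p.1.scope 1, (bitsAt p.2 p.1.scope 2, bitsAt p.2 p.1.scope 3)))) :=
    ((bitsAtFP 0).comp hAs).pair (((bitsAtFP 1).comp hAs).pair (((bitsAtFP 2).comp hAs).pair ((bitsAtFP 3).comp hAs)))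
  -- for each kind and flag, the table
  have htab : ∀ (k : ℕ) (fl : Bool), CodeFP (pairE recE assocE) zoE
      (fun p => evalBits k fl (bitsAt p.2 p.1.scope 0) (bitsAt p.2 p.1.scope 1) (bitsAt p.2 p.1.scope 2) (bitsAt p.2 p.1.scope 3)) :=
    fun k fl => ((evalBitsFP k fl).comp hbits).congr fun _ => rfl
  -- dispatch on the flag
  have hflag : ∀ k : ℕ, CodeFP (pairE recE assocE) zoE
      (fun p => evalBits k p.1.flag (bitsAt p.2 p.1.scope 0) (bitsAt p.2 p.1.scope 1) (bitsAt p.2 p.1.scope 2) (bitsAt p.2 p.1.scope 3)) :=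
    fun k => (hfl.ite (htab k true) (htab k false)).congr fun p => by cases p.1.flag <;> rfl
  -- dispatch on the kind
  have hkind : ∀ j : ℕ, CodeFP (pairE recE assocE) bitE (fun p => decide (p.1.kind = j)) := fun j => natEq.comp (hk.pair (const _ j))
  have key : ∀ (p : NodeRec × List (ℕ × ℕ)), 7 ≤ p.1.kind →
      evalBits p.1.kind p.1.flag (bitsAt p.2 p.1.scope 0) (bitsAt p.2 p.1.scope 1) (bitsAt p.2 p.1.scope 2) (bitsAt p.2 p.1.scope 3) = 0 := by
    intro p hp
    unfold evalBits
    rw [if_neg (by omega), if_neg (by omega), if_neg (by omega), if_neg (by omega), if_neg (by omega), if_neg (by omega)]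
  refine (((hkind 0).ite (hflag 0) ((hkind 1).ite (hflag 1) ((hkind 2).ite (hflag 2) ((hkind 3).ite (hflag 3)
    ((hkind 4).ite (hflag 4) ((hkind 5).ite (hflag 5) ((hkind 6).ite (hflag 6) (const _ 0)))))))).congr fun p => ?_)
  rw [eval_eq_evalBits]
  simp only [decide_eq_true_eq]
  by_cases h0 : p.1.kind = 0; · simp [h0]
  by_cases h1 : p.1.kind = 1; · simp [h1]
  by_cases h2 : p.1.kind = 2; · simp [h2]
  by_cases h3 : p.1.kind = 3; · simp [h3]
  by_cases h4 : p.1.kind = 4; · simp [h4]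
  by_cases h5 : p.1.kind = 5; · simp [h5]
  by_cases h6 : p.1.kind = 6; · simp [h6]
  rw [if_neg h0, if_neg h1, if_neg h2, if_neg h3, if_neg h4, if_neg h5, if_neg h6]
  exact (key p (by omega)).symm

/-- **The record operations are realised on codes.** [cite: AroraBarak2009, §1.3] -/
theorem codeFactors_rec : CodeFactors recOps recE zoE where
  scope := dataFP.snd'.snd'
  feval := fevalFP

/-- The entries of `recOps` have coefficient norm `≤ 1`. [folklore] -/
theorem cn_feval_le (φ : NodeRec) (a : ℕ → ℕ) : cn (recOps.feval φ a) ≤ 1 := cn_eval_le φ a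

end NodeRec

end Literature.Barriers.QuantumAdvantage

end
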